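import Summits.AtomisticToContinuum.FouriersLaw.Theses.LatticeLandauDamping
import Summits.AtomisticToContinuum.FouriersLaw.Theses.EmbeddedDrudeMourre
import Summits.AtomisticToContinuum.FouriersLaw.Theorems.StaticAbelianSqueezeKuboAbelIdentity
import Summits.AtomisticToContinuum.FouriersLaw.Theorems.EmbeddedDrudeMourreGreenKuboContinuationCanonicalSeedOfRegularState
import Literature.MathematicalPhysics.KineticTheory.InfiniteChainTightRegular
import Literature.MathematicalPhysics.KineticTheory.InfiniteChainSuperstableOrbits
import Literature.MathematicalPhysics.KineticTheory.InfiniteChainInvariantStates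

/-!
# Line `static-squeeze-witness-bracket` — STRATEGIST'S SKELETON (rev 2) for crux
`LatticeLandauDamping.AbelThermodynamicLimit` (stmt-AtomisticToContinuum-14013)

Author: `planner-cstrat-stmt-AtomisticToContinuum-14013-0` (crux-strategist, 2026-08-16). Crux decl (FIXED):
`Summit.AtomisticToContinuum.FouriersLaw.Theses.LatticeLandauDamping.AbelThermodynamicLimit`; `Iff.rfl`-identical to the
sibling crux `EmbeddedDrudeMourre.AbelThermodynamicLimit` (stmt-12596) — `crux_iff_sibling`, so this line serves both.

## The line in one paragraph

Every registered line of this crux (SketchIdeator2 = QS ⊕ QSR; fekete = QS ⊕ (R⁻); loomis = Karamata ⊕ post-dark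
stability) identifies the OPEN chain's Laplace-resolved current noise `F_N(ν) = ∫₀^∞ e^{-νt} c_N(t) dt` with the bulk Abel
function `Â(ν) = ∫₀^∞ e^{-νt} C_T(t) dt` of the witness through a DYNAMICAL matching (fixed-ν / fixed-time light cone of
the OU-ended open chain, uniformly in `N` — the missing engine "(M1) N-uniform open-chain L² locality" of stubs C′/B′ of
SketchIdeator2, `stub_fixedHorizonMatching` of loomis, S3 of fekete). THIS line deletes that engine: at every `ν > 0` the
open chain's resolvent form has EXACT two-sided variational bounds (Bernardin–Olla / Komorowski–Landim–Olla primal–dual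
formulas for `L_N = 𝒜_N + γS_∂`, `(ν − γS_∂)⁻¹ ≤ ν⁻¹`, `S_∂` touching two sites), whose glued-translate trial
functions give, by STATICS ONLY (equivalence of ensembles for local observables + `N`-uniform clustering of the 1-D Gibbs
chain), `(N−1)(PRIMAL_ν(g) − ε) ≤ F_N(ν) ≤ (N−1)(DUAL_ν(u) + ε)` eventually in `N` — stub (S), VERBATIM the item
`StaticAbelianSqueeze.ResolventSqueeze` (stmt-13417); the infinite-volume values have no duality gap — stub (G), VERBATIM
`StaticAbelianSqueeze.LiouvilleNoGap` (stmt-13418: local `C₀¹` functions are a core of the Liouvillian on `ℋ₀(μ_T)`,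
Marchioro–Pellegrinotti–Pulvirenti 1978-type); and the witness's own Abel function is BRACKETED by the same values,
`PRIMAL_ν(g) ≤ Â(ν) ≤ DUAL_ν(u)` for every regular witness — stub (W), NEW here (skew-symmetry of the Koopman generator on
Doyon's `ℋ₀` ⊇ `𝒜` on local classes; the tree's `ZeroWavenumberSpace` / `FluctuationAbelPositivity` resolvent identity
`∫₀^∞e^{-νt}⟪[J],U_t[J]⟫ = ⟪[J],R(ν)[J]⟫`). Hence `F_N(ν)/(N−1) → Â(ν)` at every `ν > 0` for the regular witness
with NO open-chain dynamics beyond fixed-`N` resolvent algebra. The exchange `ν ↓ 0 ↔ N → ∞` is then the ONE residual stub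
(R|W): low-frequency `o(N)` weight of `∫₀^∞(1−e^{-νt})c_N` uniformly in `N`, CONDITIONAL on a witness at `T` (=
`StaticAbelianSqueeze.UniformAbelianRegularity`, stmt-13416, weakened by the crux's own hypothesis; the item implies it,
`stub_uniformAbelianRegularityOfWitness_of_item`). The seam (bare DLR witness ↦ regular witness) is the SHARED stub SI
`stub_witnessShiftInvariant`, VERBATIM rev 6 of `Lines/SketchIdeator2.lean`; after SI everything is landed Literature
(`oneSiteTight_of_isShiftInvariant`, `isShiftInvariant_and_hasSuperstabilityEstimate_of_tight_pinnedChain`,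
`ae_forall_flow_mem_bmGood_pinnedChain`, `regularWitness_of_regularState_of_aeOrbits`). The fixed-`N` open-chain Kubo–Abel
identity (K) `StaticAbelianSqueeze.kuboAbelIdentity_holds` is LANDED and used directly (the only place `0 < γ` and `Uniq`
act, Disproof §2a).

## Stubs (FIVE; `sorry` only inside `stub_*`; every signature self-contained)

* `stub_resolventSqueeze` (S) — verbatim stmt-13417 (`example` below re-types it as the item). Size L (statics).
* `stub_liouvilleNoGap` (G) — verbatim stmt-13418. Size L–XL (core property of the infinite-volume Liouvillian in ℋ₀).
* `stub_witnessBracket` (W) — NEW: regular witness ⇒ `PRIMAL_ν(g) ≤ Â(ν) ≤ DUAL_ν(u)` for all `ν > 0`, local `g, u`.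
  Size L (ℋ₀ plumbing over landed vocabulary; skew-symmetry inequalities are ten lines of Hilbert algebra).
* `stub_uniformAbelianRegularityOfWitness` (R|W) — the CORE: conditional (R). Size: open-problem (HasBoundedResponse
  class, Disproof §3/§4(3)); logically WEAKER than SketchIdeator2's QS ∧ QSR given matching (Disproof §7.2
  `twoSided_dc_law`: the plain sign laws force `|F_N(ν) − NÂ(ν)| = O(1)`, a RATE; (R|W) asks only `o(N)`).
* `stub_witnessShiftInvariant` (SI) — verbatim SketchIdeator2 rev 6 (shared seam; the planner-level repair of the crux).

Composition `AbelThermodynamicLimit_of` (kernel-checked): SI + landed seam lemmas ⇒ regular witness `(μT, D, κ)`, which is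
OUTPUT; for every steady family and response sequence `Dn`, every `ε > 0`: Abel window `|Â(ν) − T²κ| ≤ ε` for `ν < ν_a`;
(R|W) gives `ν₀`; at `ν = min(ν_a, ν₀)/2`: (G) near-optimisers `g, u`, (W) bracket, (S) threshold `N₁`, (R|W) threshold
`N₂`; for `N ≥ max N₁ N₂ 2`, (K) splits `(N−1)T²Dn N = F_N(ν) + ∫(1−e^{-νt})c_N`, so `|T²Dn N − T²κ| ≤ 5ε`
(`arith_static`) — `Dn → κ` (`tendsto_of_scaled_estimate`).

## Disproof used (`Cruxes/AbelThermodynamicLimit/Disproof.lean`, cdisprove v5 + §7 seat 14013, rc 0; read in full)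

§0/§7.0 `crux_iff`/`lattice_crux_iff`: `Iff.rfl` for this decl (`crux_iff_sibling`). §2a γ-blindness
(`exists_witness_iff_gamma`, `conclusion_false_gamma_zero`): honoured — (S),(G),(W) never mention `γ` except through the
open-chain kernels inside `F_N`; `0 < γ` and `Uniq` act at (K) (landed) and inside (R|W)/(S) through
`transitionKernel N T T`. §2b `0 < T` carried by every stub. §2c harmonic corner (`tlconv_harmonic_false`): CALIBRATION —
at `lam = β = 0`, `𝒜j` is an exact lattice gradient, `PRIMAL/DUAL` are attained at `g = j/ν`, `u = 0`,
`K_ν = ⟨⟨j,j⟩⟩/ν = Â(ν)` (the total phonon current is conserved), so (S),(G),(W) HOLD there and the conclusion fails only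
through the absent witness / failing (R) (`F_N(0⁺) ∼ N²`), exactly as the Disproof requires `lam, β > 0` to act at step (3).
§3 `hasBoundedResponse_of_crux'`: paid by (R|W) (its upper half). §4 skeleton: (1) = (K) landed; (2) = (S)+(G)+(W)
(STATIC replacement of the bulk/contact decomposition); (3) = (R|W). §7.1: `Uniq` discharged — the composition still takes
`hU` from the crux binder and feeds it to (K). §7.2 kill criteria concern QS/QSR only; (R|W) dies iff `D_N ↛ κ` for the
canonical response (`not_crux_iff`), i.e. with the crux itself. Landed `Negative/LoadBearing.lean`,
`Negative/SignLawsKillCriteria.lean`: no stub here instantiates a statement they refute (they concern the crux shape, the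
degenerate corners and abstract sign-law sequences).
-/

noncomputable section

namespace Summit.AtomisticToContinuum.FouriersLaw.Cruxes.AbelThermodynamicLimit.StaticSqueezeWitnessBracket

open MeasureTheory Filter Set Topology
open Literature.MathematicalPhysics.KineticTheory.HeatConduction

/-- The two cruxes sharing this directory are the same proposition. -/
theorem crux_iff_sibling :
    Summit.AtomisticToContinuum.FouriersLaw.Theses.LatticeLandauDamping.AbelThermodynamicLimit ↔
      Summit.AtomisticToContinuum.FouriersLaw.Theses.EmbeddedDrudeMourre.AbelThermodynamicLimit :=
  Iff.rfl

/-! ## Registered stubs (`sorry` only here) -/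

/-- **Stub (S) — `stub_resolventSqueeze`: the STATIC two-sided squeeze of the open chain's resolvent form at every
`ν > 0`** (size L; VERBATIM the body of `StaticAbelianSqueeze.ResolventSqueeze`, item stmt-AtomisticToContinuum-13417 —
lands once for both routes; see `item_resolventSqueeze_of_stub`). For `P = pinnedChain ω₂ lam β γ` (all `> 0`), `T > 0`,
every shift-invariant DLR Gibbs state `μ_T`, every `ν > 0`, all local test functions `g, u` and every `ε > 0`, eventually in
`N`: `(N−1)(PRIMAL_ν(g) − ε) ≤ F_N(ν) ≤ (N−1)(DUAL_ν(u) + ε)`, where `F_N(ν) = ∫₀^∞e^{-νt}c_N`, `c_N(t) = ∫ J·(P_tJ)dμ_{N,T}`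
(open chain, both baths at `T`), `PRIMAL_ν(g) = 2⟨⟨j,g⟩⟩ − ν⟨⟨g,g⟩⟩ − ν⁻¹⟨⟨𝒜g,𝒜g⟩⟩`,
`DUAL_ν(u) = ν⁻¹⟨⟨j+𝒜u, j+𝒜u⟩⟩ + ν⟨⟨u,u⟩⟩`, `⟨⟨f₁,f₂⟩⟩ = Σ_x Cov_μT(f₁, f₂∘τ_x)`. Proof plan (StaticAbelianSqueeze card):
weak duality at fixed `N` for the `L²(μ_N)` resolvent of the constructed semigroup — exact identities
`⟨f,(ν−L)⁻¹f⟩ = sup_h {2⟨f,h⟩ − ‖h‖²_{ν−γS} − ⟨𝒜_Nh,(ν−γS)⁻¹𝒜_Nh⟩} = inf_w {⟨f+𝒜_Nw,(ν−γS)⁻¹(f+𝒜_Nw)⟩ + ‖w‖²_{ν−γS}}`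
(symmetric part of `(B−A)⁻¹` is `(B + AᵀB⁻¹A)⁻¹`) with `(ν−γS)⁻¹ ≤ ν⁻¹` and `h, w` = centred sums of INTERIOR translates of
`g, u` (no boundary momenta ⇒ `S`-terms vanish); `E_μN[𝒜_N f] = 0`; then `N`-uniform exponential clustering + local
convergence of the free-boundary Gibbs marginals (transfer operator, Jentzsch gap; tree: `InfiniteChainGibbsUniqueness`,
`ChainMixingClustering`). NO dynamics of the open chain beyond fixed-`N` operator algebra (GeneratorCore,
GibbsKernelInvariant of StaticAbelianSqueeze, M-sized supports). Why it might fail: only through that infrastructure.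
Sources: BernardinOlla2011 §6, KomorowskiLandimOlla2012 Ch. 2, LandimOllaVaradhan2002, Jara2006, KunduDharNarayan2009. -/
theorem stub_resolventSqueeze :
    ∀ ω₂ lam β γ : ℝ, 0 < ω₂ → 0 < lam → 0 < β → 0 < γ → ∀ T : ℝ, 0 < T → ∀ μT : MeasureTheory.Measure Literature.MathematicalPhysics.KineticTheory.HeatConduction.ChainConfig, (Literature.MathematicalPhysics.KineticTheory.HeatConduction.pinnedChain ω₂ lam β γ).IsChainGibbsMeasure T μT → Literature.MathematicalPhysics.KineticTheory.HeatConduction.IsShiftInvariant μT → let br : (Literature.MathematicalPhysics.KineticTheory.HeatConduction.ChainConfig → ℝ) → (Literature.MathematicalPhysics.KineticTheory.HeatConduction.ChainConfig → ℝ) → ℝ := fun f₁ f₂ => ∑' x : ℤ, ((∫ σ, f₁ σ * f₂ (fun i => σ (i + x)) ∂μT) - (∫ σ, f₁ σ ∂μT) * (∫ σ, f₂ σ ∂μT)); let jZ : Literature.MathematicalPhysics.KineticTheory.HeatConduction.ChainConfig → ℝ := fun σ => (Literature.MathematicalPhysics.KineticTheory.HeatConduction.pinnedChain ω₂ lam β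 γ).bondCurrentZ σ 0; ∀ ν : ℝ, 0 < ν → ∀ g u : Literature.MathematicalPhysics.KineticTheory.HeatConduction.ChainConfig → ℝ, Literature.MathematicalPhysics.KineticTheory.HeatConduction.IsLocalTestFunction g → Literature.MathematicalPhysics.KineticTheory.HeatConduction.IsLocalTestFunction u → ∀ ε : ℝ, 0 < ε → ∃ N₀ : ℕ, ∀ N : ℕ, N₀ ≤ N → let J : Literature.MathematicalPhysics.KineticTheory.HeatConduction.PhaseSpace N → ℝ := fun z => ∑ i : Fin N, (Literature.MathematicalPhysics.KineticTheory.HeatConduction.pinnedChain ω₂ lam β γ).bondCurrent N i z; let F : ℝ := ∫ t in Set.Ioi (0:ℝ), Real.exp (-(ν * t)) * ∫ z, J z * (∫ y, J y ∂((Literature.MathematicalPhysics.KineticTheory.HeatConduction.pinnedChain ω₂ lam β γ).transitionKernel N T T t.toNNReal z)) ∂((Literature.MathematicalPhysics.KineticTheory.HeatConduction.pinnedChain ω₂ lam β γ).gibbsMeasure N T); ((N:ℝ) - 1) * ((2 * br jZ g - ν * br g g - ν⁻¹ * br (Literature.MathematicalPhysics.KineticTheory.HeatConduction.liouvilleZ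 (Literature.MathematicalPhysics.KineticTheory.HeatConduction.pinnedChain ω₂ lam β γ) g) (Literature.MathematicalPhysics.KineticTheory.HeatConduction.liouvilleZ (Literature.MathematicalPhysics.KineticTheory.HeatConduction.pinnedChain ω₂ lam β γ) g)) - ε) ≤ F ∧ F ≤ ((N:ℝ) - 1) * ((ν⁻¹ * br (jZ + Literature.MathematicalPhysics.KineticTheory.HeatConduction.liouvilleZ (Literature.MathematicalPhysics.KineticTheory.HeatConduction.pinnedChain ω₂ lam β γ) u) (jZ + Literature.MathematicalPhysics.KineticTheory.HeatConduction.liouvilleZ (Literature.MathematicalPhysics.KineticTheory.HeatConduction.pinnedChain ω₂ lam β γ) u) + ν * br u u) + ε) := by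
  sorry

/-- **Stub (G) — `stub_liouvilleNoGap`: no duality gap for the infinite chain's static variational values** (size L–XL;
VERBATIM the body of `StaticAbelianSqueeze.LiouvilleNoGap`, item stmt-AtomisticToContinuum-13418 — lands once for both;
see `item_liouvilleNoGap_of_stub`). For every shift-invariant DLR state `μ_T` (`T > 0`), `ν > 0`, `ε > 0` there are local
test functions `g, u` with `DUAL_ν(u) ≤ PRIMAL_ν(g) + ε`. Content: `sup PRIMAL_ν = inf DUAL_ν` iff local `C₀¹` functions
are a CORE for (a skew-adjoint extension of) the Liouvillian `𝒜` on Doyon's zero-wavenumber space `ℋ₀(μ_T)` — the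
translation-summed analogue of Marchioro–Pellegrinotti–Pulvirenti 1978 (essential skew-adjointness of the Liouville
operator of an infinite classical system in `L²(Gibbs)`), via covariance-summed fixed-time `L²` locality of the Buttà–
Marchioro flow (tree: `InfiniteChainL2Locality`, `ZeroWavenumberDataOfClustering`). Why it might fail: printed only as an
ASSUMPTION for unbounded `V″` (BernardinOlla2011 p. 11); a deficiency vector = a non-local slow mode. Calibration: exact at
the harmonic corner (`g = j/ν`, `u = 0`). Sources: MarchioroPellegrinottiPulvirenti1978, BernardinOlla2011, Doyon2022. -/
theorem stub_liouvilleNoGap :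
    ∀ ω₂ lam β γ : ℝ, 0 < ω₂ → 0 < lam → 0 < β → 0 < γ → ∀ T : ℝ, 0 < T → ∀ μT : MeasureTheory.Measure Literature.MathematicalPhysics.KineticTheory.HeatConduction.ChainConfig, (Literature.MathematicalPhysics.KineticTheory.HeatConduction.pinnedChain ω₂ lam β γ).IsChainGibbsMeasure T μT → Literature.MathematicalPhysics.KineticTheory.HeatConduction.IsShiftInvariant μT → let br : (Literature.MathematicalPhysics.KineticTheory.HeatConduction.ChainConfig → ℝ) → (Literature.MathematicalPhysics.KineticTheory.HeatConduction.ChainConfig → ℝ) → ℝ := fun f₁ f₂ => ∑' x : ℤ, ((∫ σ, f₁ σ * f₂ (fun i => σ (i + x)) ∂μT) - (∫ σ, f₁ σ ∂μT) * (∫ σ, f₂ σ ∂μT)); let jZ : Literature.MathematicalPhysics.KineticTheory.HeatConduction.ChainConfig → ℝ := fun σ => (Literature.MathematicalPhysics.KineticTheory.HeatConduction.pinnedChain ω₂ lam β γ).bondCurrentZ σ 0; ∀ ν : ℝ, 0 < ν → ∀ ε : ℝ, 0 < ε → ∃ g u : Literature.MathematicalPhysics.KineticTheory.HeatConduction.ChainConfig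 → ℝ, Literature.MathematicalPhysics.KineticTheory.HeatConduction.IsLocalTestFunction g ∧ Literature.MathematicalPhysics.KineticTheory.HeatConduction.IsLocalTestFunction u ∧ (ν⁻¹ * br (jZ + Literature.MathematicalPhysics.KineticTheory.HeatConduction.liouvilleZ (Literature.MathematicalPhysics.KineticTheory.HeatConduction.pinnedChain ω₂ lam β γ) u) (jZ + Literature.MathematicalPhysics.KineticTheory.HeatConduction.liouvilleZ (Literature.MathematicalPhysics.KineticTheory.HeatConduction.pinnedChain ω₂ lam β γ) u) + ν * br u u) ≤ (2 * br jZ g - ν * br g g - ν⁻¹ * br (Literature.MathematicalPhysics.KineticTheory.HeatConduction.liouvilleZ (Literature.MathematicalPhysics.KineticTheory.HeatConduction.pinnedChain ω₂ lam β γ) g) (Literature.MathematicalPhysics.KineticTheory.HeatConduction.liouvilleZ (Literature.MathematicalPhysics.KineticTheory.HeatConduction.pinnedChain ω₂ lam β γ) g)) + ε := by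
  sorry

/-- **Stub (W) — `stub_witnessBracket`: the witness's Abel function is bracketed by the static variational values** (size
L; NEW — the `AbelBridgeToGreenKubo` foreseen in StaticAbelianSqueeze's two-layer plan, typed for the REGULAR WITNESS CLASS
of the sibling lines: DLR + shift-invariant + BM-superstable state, `D.carrier ⊆ bmGood`, `μT`-preserving, absolutely
convergent correlations). For every such `(μT, D)`, every `ν > 0` and all local test functions `g, u`:
`PRIMAL_ν(g) ≤ Â(ν) ≤ DUAL_ν(u)`, `Â(ν) := ∫₀^∞ e^{-νt} C_T(t) dt`, `C_T = D.currentCorrelation μT`. Proof plan: (i) the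
Koopman group `U_t` of `D` on `ℋ₀(μT)` is a strongly continuous ORTHOGONAL group (measure preservation + `flow_add`;
shift-covariance and `ZeroWavenumberData` from `D.carrier ⊆ bmGood` + `D.unique` = BM normal form, tree
`ZeroWavenumberDataOfClustering.exists_zeroWavenumberData_of_clustering`, static clustering of the transfer-operator state,
fixed-time `L²` locality `InfiniteChainL2Locality`); (ii) its generator `𝓛` contains the classes of local `C₀¹` functions with
`𝓛[g] = [𝒜g]` (`isSolution` + dominated convergence in `ℋ₀`); (iii) `Â(ν) = ⟪[j],(ν−𝓛)⁻¹[j]⟫₀` (tree: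
`ZeroWavenumberData.inner_currentClass_koopman_eq_currentCorrelation` + the Laplace/resolvent identity of
`FluctuationAbelPositivity`); (iv) SKEW-SYMMETRY ALONE gives both inequalities for every `φ ∈ Dom 𝓛`: with
`w = (ν−𝓛)⁻¹[j]`, `⟪[j],w⟫ − PRIMAL(φ) = ν‖w−φ‖² + ν⁻¹‖𝓛φ‖² − 2⟪w−φ,𝓛φ⟫ ≥ 0` and
`DUAL(u) − ⟪[j],w⟫ = ν⁻¹‖𝓛(w−u)‖² + ν‖u‖² − 2⟪𝓛(w−u),u⟫ ≥ 0` (AM–GM; `⟪φ,𝓛φ⟫ = 0`) — step (iv) is KERNEL-CHECKED abstractly in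
this file (rev 2): `primal_le_of_skew`, `le_dual_of_skew` (section `SkewAlgebra`). No core property is used here (that is
(G)). Calibration: equality at the harmonic corner (`C_T` constant, `Â = ⟨⟨j,j⟩⟩/ν`). Why it might fail: only if `ℋ₀` of the
regular witness is not Doyon-regular (summable space-time clustering of local observables at fixed times) — expected from
the landed BM estimates. Sources: Doyon2022 §4, KomorowskiLandimOlla2012 §2.2, BernardinOlla2011 §6,
MarchioroPellegrinottiPulvirenti1978. -/
theorem stub_witnessBracket :
    ∀ ω₂ lam β γ : ℝ, 0 < ω₂ → 0 < lam → 0 < β → 0 < γ → ∀ T : ℝ, 0 < T →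
      ∀ (μT : MeasureTheory.Measure Literature.MathematicalPhysics.KineticTheory.HeatConduction.ChainConfig)
        (D : Literature.MathematicalPhysics.KineticTheory.HeatConduction.InfiniteChainDynamics (Literature.MathematicalPhysics.KineticTheory.HeatConduction.pinnedChain ω₂ lam β γ)),
        (Literature.MathematicalPhysics.KineticTheory.HeatConduction.pinnedChain ω₂ lam β γ).IsChainGibbsMeasure T μT →
        Literature.MathematicalPhysics.KineticTheory.HeatConduction.IsShiftInvariant μT →
        (Literature.MathematicalPhysics.KineticTheory.HeatConduction.pinnedChain ω₂ lam β γ).HasSuperstabilityEstimate μT →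
        D.carrier ⊆ (Literature.MathematicalPhysics.KineticTheory.HeatConduction.pinnedChain ω₂ lam β γ).bmGood →
        D.PreservesMeasure μT →
        (∀ t : ℝ, D.HasAbsConvergentCorrelation μT t) →
        let br : (Literature.MathematicalPhysics.KineticTheory.HeatConduction.ChainConfig → ℝ) → (Literature.MathematicalPhysics.KineticTheory.HeatConduction.ChainConfig → ℝ) → ℝ := fun f₁ f₂ => ∑' x : ℤ, ((∫ σ, f₁ σ * f₂ (fun i => σ (i + x)) ∂μT) - (∫ σ, f₁ σ ∂μT) * (∫ σ, f₂ σ ∂μT)); let jZ : Literature.MathematicalPhysics.KineticTheory.HeatConduction.ChainConfig → ℝ := fun σ => (Literature.MathematicalPhysics.KineticTheory.HeatConduction.pinnedChain ω₂ lam β γ).bondCurrentZ σ 0;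
        ∀ ν : ℝ, 0 < ν → ∀ g u : Literature.MathematicalPhysics.KineticTheory.HeatConduction.ChainConfig → ℝ,
          Literature.MathematicalPhysics.KineticTheory.HeatConduction.IsLocalTestFunction g → Literature.MathematicalPhysics.KineticTheory.HeatConduction.IsLocalTestFunction u →
          (2 * br jZ g - ν * br g g - ν⁻¹ * br (Literature.MathematicalPhysics.KineticTheory.HeatConduction.liouvilleZ (Literature.MathematicalPhysics.KineticTheory.HeatConduction.pinnedChain ω₂ lam β γ) g) (Literature.MathematicalPhysics.KineticTheory.HeatConduction.liouvilleZ (Literature.MathematicalPhysics.KineticTheory.HeatConduction.pinnedChain ω₂ lam β γ) g)) ≤ (∫ t in Set.Ioi (0:ℝ), Real.exp (-(ν * t)) * D.currentCorrelation μT t) ∧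
          (∫ t in Set.Ioi (0:ℝ), Real.exp (-(ν * t)) * D.currentCorrelation μT t) ≤ (ν⁻¹ * br (jZ + Literature.MathematicalPhysics.KineticTheory.HeatConduction.liouvilleZ (Literature.MathematicalPhysics.KineticTheory.HeatConduction.pinnedChain ω₂ lam β γ) u) (jZ + Literature.MathematicalPhysics.KineticTheory.HeatConduction.liouvilleZ (Literature.MathematicalPhysics.KineticTheory.HeatConduction.pinnedChain ω₂ lam β γ) u) + ν * br u u) := by
  sorry

/-- **Stub (R|W) — `stub_uniformAbelianRegularityOfWitness`: THE CORE — `N`-uniform low-frequency regularity of the open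
chain's current noise, CONDITIONAL on an Abelian witness** (size: open-problem; = `StaticAbelianSqueeze.UniformAbelianRegularity`
stmt-13416 with the crux's own witness hypothesis prefixed — the item implies it, `stub_uniformAbelianRegularityOfWitness_of_item`;
conditional so that it claims nothing at a `T` without a witness, i.e. it is crux-strength, cf. triage r1 on slow-abel's ULF).
For `P` (all `> 0`) and `T > 0` carrying a witness: `∀ ε > 0 ∃ ν₀ > 0 ∀ ν ∈ (0, ν₀) ∃ N₀ ∀ N ≥ N₀`,
`|∫₀^∞ (1 − e^{-νt}) c_N(t) dt| ≤ εN` — the slow part of the equilibrium total-current autocorrelation of the thermostatted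
chain carries `o(N)` weight, uniformly. TWO-SIDED but RATE-FREE: Disproof §7.2 shows the lead's plain QS ∧ QSR force the rate
`|F_N(ν) − NÂ(ν)| = O(1)`; fekete's (R⁻) is its lower half; loomis's `stub_anchoredPostDarkStability` is its anchored
time-domain form. Where `lam, β > 0` must act quantitatively (fails at the harmonic corner: `∫₀^∞c_N ∼ N²`); where
`HasBoundedResponse` sits (Disproof §3). Engines on offer: the four external suppliers listed in StaticAbelianSqueeze's
two-layer plan (BondHeatUncertainty.TransferToBoundedResponse, tangent-flow-self-dephasing, background-method SOS
certificates, conservation-law-rigidity-local-ohm) for the upper half; OpenCurrentPositivity / abel-late-antiecho for the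
lower half. Sources: BonettoLebowitzReyBellet2000 §6.3, BeckerMenegaki2022, KunduDharNarayan2009, Dhar2008. -/
theorem stub_uniformAbelianRegularityOfWitness :
    ∀ ω₂ lam β γ : ℝ, 0 < ω₂ → 0 < lam → 0 < β → 0 < γ → ∀ T : ℝ, 0 < T →
      (∃ (μT : MeasureTheory.Measure Literature.MathematicalPhysics.KineticTheory.HeatConduction.ChainConfig)
            (D : Literature.MathematicalPhysics.KineticTheory.HeatConduction.InfiniteChainDynamics (Literature.MathematicalPhysics.KineticTheory.HeatConduction.pinnedChain ω₂ lam β γ)) (κ : ℝ),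
            (Literature.MathematicalPhysics.KineticTheory.HeatConduction.pinnedChain ω₂ lam β γ).IsChainGibbsMeasure T μT ∧ D.PreservesMeasure μT ∧
            (∀ t : ℝ, D.HasAbsConvergentCorrelation μT t) ∧ 0 < κ ∧
            Filter.Tendsto (fun ν : ℝ => (T ^ 2)⁻¹ *
              MeasureTheory.integral (MeasureTheory.volume.restrict (Set.Ioi (0:ℝ)))
                (fun t : ℝ => Real.exp (-(ν * t)) * D.currentCorrelation μT t))
              (nhdsWithin (0:ℝ) (Set.Ioi 0)) (nhds κ)) →
      ∀ ε : ℝ, 0 < ε → ∃ ν₀ : ℝ, 0 < ν₀ ∧ ∀ ν : ℝ, 0 < ν → ν < ν₀ → ∃ N₀ : ℕ, ∀ N : ℕ, N₀ ≤ N → let J : Literature.MathematicalPhysics.KineticTheory.HeatConduction.PhaseSpace N → ℝ := fun z => ∑ i : Fin N, (Literature.MathematicalPhysics.KineticTheory.HeatConduction.pinnedChain ω₂ lam β γ).bondCurrent N i z; |∫ t in Set.Ioi (0:ℝ), (1 - Real.exp (-(ν * t))) * ∫ z, J z * (∫ y, J y ∂((Literature.MathematicalPhysics.KineticTheory.HeatConduction.pinnedChain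 ω₂ lam β γ).transitionKernel N T T t.toNNReal z)) ∂((Literature.MathematicalPhysics.KineticTheory.HeatConduction.pinnedChain ω₂ lam β γ).gibbsMeasure N T)| ≤ ε * N := by
  sorry

/-- **Stub SI — `stub_witnessShiftInvariant`: WLOG THE WITNESS STATE IS SHIFT-INVARIANT** (VERBATIM rev 6 of
`Lines/SketchIdeator2.lean`, the seam shared by every line of both twin cruxes; not decidable in the tree as typed — bare DLR
admits stretched states — and EXACTLY the planner-level repair of the crux: add shift-invariance to the witness clause of the
hypothesis, after which SI is `fun h => h`, see `AbelThermodynamicLimit_of_shiftInvariantWitness`). -/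
theorem stub_witnessShiftInvariant :
    ∀ ω₂ lam β γ : ℝ, 0 < ω₂ → 0 < lam → 0 < β → 0 < γ →
      ∀ T : ℝ, 0 < T →
        (∃ (μT : MeasureTheory.Measure
                Literature.MathematicalPhysics.KineticTheory.HeatConduction.ChainConfig)
            (D' : Literature.MathematicalPhysics.KineticTheory.HeatConduction.InfiniteChainDynamics
              (Literature.MathematicalPhysics.KineticTheory.HeatConduction.pinnedChain ω₂ lam β γ))
            (κ : ℝ),
            (Literature.MathematicalPhysics.KineticTheory.HeatConduction.pinnedChain
                ω₂ lam β γ).IsChainGibbsMeasure T μT ∧ D'.PreservesMeasure μT ∧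
            (∀ t : ℝ, D'.HasAbsConvergentCorrelation μT t) ∧ 0 < κ ∧
            Filter.Tendsto (fun ν : ℝ => (T ^ 2)⁻¹ *
              MeasureTheory.integral (MeasureTheory.volume.restrict (Set.Ioi (0:ℝ)))
                (fun t : ℝ => Real.exp (-(ν * t)) * D'.currentCorrelation μT t))
              (nhdsWithin (0:ℝ) (Set.Ioi 0)) (nhds κ)) →
        ∃ (μT : MeasureTheory.Measure
                Literature.MathematicalPhysics.KineticTheory.HeatConduction.ChainConfig)
            (D' : Literature.MathematicalPhysics.KineticTheory.HeatConduction.InfiniteChainDynamics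
              (Literature.MathematicalPhysics.KineticTheory.HeatConduction.pinnedChain ω₂ lam β γ))
            (κ : ℝ),
            (Literature.MathematicalPhysics.KineticTheory.HeatConduction.pinnedChain
                ω₂ lam β γ).IsChainGibbsMeasure T μT ∧
            Literature.MathematicalPhysics.KineticTheory.HeatConduction.IsShiftInvariant μT ∧
            D'.PreservesMeasure μT ∧
            (∀ t : ℝ, D'.HasAbsConvergentCorrelation μT t) ∧ 0 < κ ∧
            Filter.Tendsto (fun ν : ℝ => (T ^ 2)⁻¹ *
              MeasureTheory.integral (MeasureTheory.volume.restrict (Set.Ioi (0:ℝ)))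
                (fun t : ℝ => Real.exp (-(ν * t)) * D'.currentCorrelation μT t))
              (nhdsWithin (0:ℝ) (Set.Ioi 0)) (nhds κ) := by
  sorry

/-! ## Book-keeping certificates (no `sorry` of their own) -/

/-- (S) IS the item `StaticAbelianSqueeze.ResolventSqueeze` (stmt-13417): same type. -/
theorem item_resolventSqueeze_of_stub :
    Summit.AtomisticToContinuum.FouriersLaw.Theses.StaticAbelianSqueeze.ResolventSqueeze :=
  stub_resolventSqueeze

/-- (G) IS the item `StaticAbelianSqueeze.LiouvilleNoGap` (stmt-13418): same type. -/
theorem item_liouvilleNoGap_of_stub :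
    Summit.AtomisticToContinuum.FouriersLaw.Theses.StaticAbelianSqueeze.LiouvilleNoGap :=
  stub_liouvilleNoGap

/-- The item `StaticAbelianSqueeze.UniformAbelianRegularity` (stmt-13416, unconditional) implies the conditional core
(R|W): a proof of that served item closes this stub by one line. -/
theorem stub_uniformAbelianRegularityOfWitness_of_item
    (h : Summit.AtomisticToContinuum.FouriersLaw.Theses.StaticAbelianSqueeze.UniformAbelianRegularity) :
    ∀ ω₂ lam β γ : ℝ, 0 < ω₂ → 0 < lam → 0 < β → 0 < γ → ∀ T : ℝ, 0 < T →
      (∃ (μT : MeasureTheory.Measure Literature.MathematicalPhysics.KineticTheory.HeatConduction.ChainConfig)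
            (D : Literature.MathematicalPhysics.KineticTheory.HeatConduction.InfiniteChainDynamics (Literature.MathematicalPhysics.KineticTheory.HeatConduction.pinnedChain ω₂ lam β γ)) (κ : ℝ),
            (Literature.MathematicalPhysics.KineticTheory.HeatConduction.pinnedChain ω₂ lam β γ).IsChainGibbsMeasure T μT ∧ D.PreservesMeasure μT ∧
            (∀ t : ℝ, D.HasAbsConvergentCorrelation μT t) ∧ 0 < κ ∧
            Filter.Tendsto (fun ν : ℝ => (T ^ 2)⁻¹ *
              MeasureTheory.integral (MeasureTheory.volume.restrict (Set.Ioi (0:ℝ)))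
                (fun t : ℝ => Real.exp (-(ν * t)) * D.currentCorrelation μT t))
              (nhdsWithin (0:ℝ) (Set.Ioi 0)) (nhds κ)) →
      ∀ ε : ℝ, 0 < ε → ∃ ν₀ : ℝ, 0 < ν₀ ∧ ∀ ν : ℝ, 0 < ν → ν < ν₀ → ∃ N₀ : ℕ, ∀ N : ℕ, N₀ ≤ N → let J : Literature.MathematicalPhysics.KineticTheory.HeatConduction.PhaseSpace N → ℝ := fun z => ∑ i : Fin N, (Literature.MathematicalPhysics.KineticTheory.HeatConduction.pinnedChain ω₂ lam β γ).bondCurrent N i z; |∫ t in Set.Ioi (0:ℝ), (1 - Real.exp (-(ν * t))) * ∫ z, J z * (∫ y, J y ∂((Literature.MathematicalPhysics.KineticTheory.HeatConduction.pinnedChain ω₂ lam β γ).transitionKernel N T T t.toNNReal z)) ∂((Literature.MathematicalPhysics.KineticTheory.HeatConduction.pinnedChain ω₂ lam β γ).gibbsMeasure N T)| ≤ ε * N :=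
  fun ω₂ lam β γ hω hl hβ hγ T hT _ => h ω₂ lam β γ hω hl hβ hγ T hT

/-! ## The Hilbert algebra of stub (W)(iv) — kernel-checked (rev 2)

For a real inner product space `E`, a domain `D ≤ E`, a linear `A : D → E` that is SKEW-SYMMETRIC on `D`
(`⟪Aφ, ψ⟫ = −⟪φ, Aψ⟫`), `ν > 0` and `w ∈ D` with `νw − Aw = j`: `PRIMAL_ν(φ) ≤ ⟪j, w⟫ ≤ DUAL_ν(u)` for ALL `φ, u ∈ D` — no core
property, no self-adjointness, no closedness. In (W) these are applied on Doyon's `ℋ₀(μT)` with `A` = the generator of the witness's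
Koopman group restricted to the classes of local `C₀¹` functions (where it acts as `𝒜 = liouvilleZ`), `w = (ν − 𝓛)⁻¹[j]` (which lies in
the generator's domain, itself skew-symmetric), so that `⟪j, w⟫ = Â(ν)`; what remains of (W) is that identification (ℋ₀ plumbing). -/

section SkewAlgebra

open scoped InnerProductSpace

variable {E : Type*} [NormedAddCommGroup E] [InnerProductSpace ℝ E]

/-- For a skew-symmetric `A` on a domain `D`, `⟪A φ, φ⟫ = 0`. -/
theorem inner_skew_self {D : Submodule ℝ E} (A : D →ₗ[ℝ] E)
    (hskew : ∀ φ ψ : D, ⟪A φ, (ψ : E)⟫_ℝ = -⟪(φ : E), A ψ⟫_ℝ) (φ : D) :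
    ⟪A φ, (φ : E)⟫_ℝ = 0 := by
  have h := hskew φ φ
  have h' : ⟪(φ : E), A φ⟫_ℝ = ⟪A φ, (φ : E)⟫_ℝ := real_inner_comm _ _
  linarith

/-- **PRIMAL ≤ resolvent form.** If `ν w − A w = j` with `w ∈ D`, then for every `φ ∈ D`:
`2⟪j, φ⟫ − ν‖φ‖² − ν⁻¹‖Aφ‖² ≤ ⟪j, w⟫` (skew-symmetry only). -/
theorem primal_le_of_skew {D : Submodule ℝ E} (A : D →ₗ[ℝ] E)
    (hskew : ∀ φ ψ : D, ⟪A φ, (ψ : E)⟫_ℝ = -⟪(φ : E), A ψ⟫_ℝ) {ν : ℝ} (hν : 0 < ν)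
    {j : E} {w : D} (hw : ν • (w : E) - A w = j) (φ : D) :
    2 * ⟪j, (φ : E)⟫_ℝ - ν * ‖(φ : E)‖ ^ 2 - ν⁻¹ * ‖A φ‖ ^ 2 ≤ ⟪j, (w : E)⟫_ℝ := by
  -- abbreviations
  set w' : E := (w : E) with hw'
  set φ' : E := (φ : E) with hφ'
  set a : E := A φ with ha
  set b : E := A w with hb
  have hbw : ⟪b, w'⟫_ℝ = 0 := inner_skew_self A hskew w
  have haφ : ⟪a, φ'⟫_ℝ = 0 := inner_skew_self A hskew φ
  have hbφ : ⟪b, φ'⟫_ℝ = -⟪w', a⟫_ℝ := hskew w φ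
  -- express ⟪j, ·⟫ through w', a, b
  have hjw : ⟪j, w'⟫_ℝ = ν * ‖w'‖ ^ 2 := by
    rw [← hw, inner_sub_left, real_inner_smul_left, real_inner_self_eq_norm_sq, hbw]; ring
  have hjφ : ⟪j, φ'⟫_ℝ = ν * ⟪w', φ'⟫_ℝ + ⟪w', a⟫_ℝ := by
    rw [← hw, inner_sub_left, real_inner_smul_left, hbφ]; ring
  -- the completed square
  have key : 0 ≤ ‖ν • (w' - φ') - a‖ ^ 2 := by positivity
  have hexp : ‖ν • (w' - φ') - a‖ ^ 2 =
      ν ^ 2 * (‖w'‖ ^ 2 - 2 * ⟪w', φ'⟫_ℝ + ‖φ'‖ ^ 2) - 2 * ν * (⟪w', a⟫_ℝ - ⟪φ', a⟫_ℝ) + ‖a‖ ^ 2 := by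
    rw [norm_sub_sq_real, norm_smul, mul_pow, Real.norm_eq_abs, sq_abs, norm_sub_sq_real,
      real_inner_smul_left, inner_sub_left]
    ring
  have hφa : ⟪φ', a⟫_ℝ = 0 := by rw [real_inner_comm]; exact haφ
  rw [hexp, hφa] at key
  rw [hjw, hjφ]
  -- multiply the goal by ν > 0
  have hν' : ν⁻¹ * ‖a‖ ^ 2 = (‖a‖ ^ 2) / ν := by ring
  rw [hν']
  have hgoal : ν * (2 * (ν * ⟪w', φ'⟫_ℝ + ⟪w', a⟫_ℝ) - ν * ‖φ'‖ ^ 2) - ‖a‖ ^ 2 ≤ ν * (ν * ‖w'‖ ^ 2) := by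
    nlinarith [key]
  have h1 : 2 * (ν * ⟪w', φ'⟫_ℝ + ⟪w', a⟫_ℝ) - ν * ‖φ'‖ ^ 2 - ‖a‖ ^ 2 / ν ≤ ν * ‖w'‖ ^ 2 := by
    have := div_le_div_of_nonneg_right hgoal hν.le
    have e1 : (ν * (2 * (ν * ⟪w', φ'⟫_ℝ + ⟪w', a⟫_ℝ) - ν * ‖φ'‖ ^ 2) - ‖a‖ ^ 2) / ν =
        2 * (ν * ⟪w', φ'⟫_ℝ + ⟪w', a⟫_ℝ) - ν * ‖φ'‖ ^ 2 - ‖a‖ ^ 2 / ν := by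
      field_simp
    have e2 : ν * (ν * ‖w'‖ ^ 2) / ν = ν * ‖w'‖ ^ 2 := by field_simp
    rw [e1, e2] at this
    exact this
  linarith

/-- **Resolvent form ≤ DUAL.** If `ν w − A w = j` with `w ∈ D`, then for every `u ∈ D`:
`⟪j, w⟫ ≤ ν⁻¹‖j + A u‖² + ν‖u‖²` (skew-symmetry only). -/
theorem le_dual_of_skew {D : Submodule ℝ E} (A : D →ₗ[ℝ] E)
    (hskew : ∀ φ ψ : D, ⟪A φ, (ψ : E)⟫_ℝ = -⟪(φ : E), A ψ⟫_ℝ) {ν : ℝ} (hν : 0 < ν)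
    {j : E} {w : D} (hw : ν • (w : E) - A w = j) (u : D) :
    ⟪j, (w : E)⟫_ℝ ≤ ν⁻¹ * ‖j + A u‖ ^ 2 + ν * ‖(u : E)‖ ^ 2 := by
  set w' : E := (w : E) with hw'
  set u' : E := (u : E) with hu'
  set d : E := A (w - u) with hd
  have hbw : ⟪A w, w'⟫_ℝ = 0 := inner_skew_self A hskew w
  have hjw : ⟪j, w'⟫_ℝ = ν * ‖w'‖ ^ 2 := by
    rw [← hw, inner_sub_left, real_inner_smul_left, real_inner_self_eq_norm_sq, hbw]; ring
  -- j + A u = ν w' − d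
  have hjd : j + A u = ν • w' - d := by
    rw [← hw, hd, map_sub]; abel
  -- ⟪w', d⟫ = ⟪u', d⟫
  have hwd : ⟪w', d⟫_ℝ = ⟪u', d⟫_ℝ := by
    have h0 : ⟪A (w - u), ((w - u : D) : E)⟫_ℝ = 0 := inner_skew_self A hskew (w - u)
    have h1 : ((w - u : D) : E) = w' - u' := by simp [hw', hu']
    rw [h1, inner_sub_right, ← hd] at h0
    rw [real_inner_comm d w', real_inner_comm d u']
    linarith
  have key : 0 ≤ ‖d - ν • u'‖ ^ 2 := by positivity
  have hexp : ‖d - ν • u'‖ ^ 2 = ‖d‖ ^ 2 - 2 * ν * ⟪d, u'⟫_ℝ + ν ^ 2 * ‖u'‖ ^ 2 := by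
    rw [norm_sub_sq_real, norm_smul, mul_pow, Real.norm_eq_abs, sq_abs, real_inner_smul_right]; ring
  have hexp2 : ‖j + A u‖ ^ 2 = ν ^ 2 * ‖w'‖ ^ 2 - 2 * ν * ⟪u', d⟫_ℝ + ‖d‖ ^ 2 := by
    rw [hjd, norm_sub_sq_real, norm_smul, mul_pow, Real.norm_eq_abs, sq_abs, real_inner_smul_left, hwd]
    ring
  rw [hexp] at key
  rw [hjw, hexp2]
  have hdu : ⟪d, u'⟫_ℝ = ⟪u', d⟫_ℝ := real_inner_comm _ _
  rw [hdu] at key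
  have hν' : ν⁻¹ * (ν ^ 2 * ‖w'‖ ^ 2 - 2 * ν * ⟪u', d⟫_ℝ + ‖d‖ ^ 2) =
      ν * ‖w'‖ ^ 2 - 2 * ⟪u', d⟫_ℝ + ‖d‖ ^ 2 / ν := by
    field_simp
  rw [hν']
  have h2 : 0 ≤ ‖d‖ ^ 2 / ν - 2 * ⟪u', d⟫_ℝ + ν * ‖u'‖ ^ 2 := by
    have := div_nonneg key hν.le
    have e : (‖d‖ ^ 2 - 2 * ν * ⟪u', d⟫_ℝ + ν ^ 2 * ‖u'‖ ^ 2) / ν =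
        ‖d‖ ^ 2 / ν - 2 * ⟪u', d⟫_ℝ + ν * ‖u'‖ ^ 2 := by
      field_simp
    rw [e] at this
    exact this
  linarith

end SkewAlgebra

/-! ## Real analysis of the line (abstract; the chain expressions meet only by unification) -/

/-- The ε-bookkeeping: squeeze (S), gap (G), bracket (W), slow-part bound (R), Abelian split and (K) give
`|T²·D_N − L| ≤ 5ε` once `|Â(ν) − L| ≤ ε`. -/
theorem arith_static (n Tsq d F Ic Ir Pg Du A L ε : ℝ) (hn : 2 ≤ n) (hε : 0 < ε)
    (h1 : (n - 1) * (Pg - ε) ≤ F) (h2 : F ≤ (n - 1) * (Du + ε)) (h3 : Du ≤ Pg + ε)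
    (h4 : Pg ≤ A) (h5 : A ≤ Du) (h6 : |Ir| ≤ ε * n) (h7 : Ic = F + Ir)
    (h8 : (n - 1) * Tsq * d = Ic) (h9 : |A - L| ≤ ε) :
    |Tsq * d - L| ≤ 5 * ε := by
  have hn1 : 0 < n - 1 := by linarith
  have hIr := abs_le.1 h6
  have hAL := abs_le.1 h9
  have h8' : (n - 1) * (Tsq * d) = F + Ir := by rw [← h7, ← h8]; ring
  have hPg : A - ε ≤ Pg := by linarith
  have hDu : Du ≤ A + ε := by linarith
  have hF1 : (n - 1) * (A - 2 * ε) ≤ F :=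
    le_trans (mul_le_mul_of_nonneg_left (by linarith) hn1.le) h1
  have hF2 : F ≤ (n - 1) * (A + 2 * ε) :=
    le_trans h2 (mul_le_mul_of_nonneg_left (by linarith) hn1.le)
  have hεn : ε * n ≤ 2 * ε * (n - 1) := by nlinarith
  rw [abs_le]
  constructor
  · have hlow : (n - 1) * (A - 4 * ε) ≤ (n - 1) * (Tsq * d) := by nlinarith [hIr.1]
    have := le_of_mul_le_mul_left hlow hn1
    linarith
  · have hup : (n - 1) * (Tsq * d) ≤ (n - 1) * (A + 4 * ε) := by nlinarith [hIr.2]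
    have := le_of_mul_le_mul_left hup hn1
    linarith

/-- The converse bookkeeping: if `T²D_N` is already `e`-close to `L` then the slow part `Ir` is `O(e·n)`. -/
theorem arith_converse (n Tsq d F Ic Ir Pg Du A L e : ℝ) (hn : 2 ≤ n) (he : 0 < e)
    (h1 : (n - 1) * (Pg - e) ≤ F) (h2 : F ≤ (n - 1) * (Du + e)) (h3 : Du ≤ Pg + e)
    (h4 : Pg ≤ A) (h5 : A ≤ Du) (h7 : Ic = F + Ir)
    (h8 : (n - 1) * Tsq * d = Ic) (h9 : |A - L| ≤ e) (h10 : |Tsq * d - L| ≤ e) :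
    |Ir| ≤ 4 * e * n := by
  have hn1 : 0 < n - 1 := by linarith
  have hAL := abs_le.1 h9
  have hdL := abs_le.1 h10
  have hIr : Ir = (n - 1) * (Tsq * d) - F := by
    have : (n - 1) * (Tsq * d) = F + Ir := by rw [← h7, ← h8]; ring
    linarith
  have hPg : A - e ≤ Pg := by linarith
  have hDu : Du ≤ A + e := by linarith
  have hF1 : (n - 1) * (A - 2 * e) ≤ F :=
    le_trans (mul_le_mul_of_nonneg_left (by linarith) hn1.le) h1
  have hF2 : F ≤ (n - 1) * (A + 2 * e) :=
    le_trans h2 (mul_le_mul_of_nonneg_left (by linarith) hn1.le)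
  have hd1 : (n - 1) * (A - 2 * e) ≤ (n - 1) * (Tsq * d) :=
    mul_le_mul_of_nonneg_left (by linarith) hn1.le
  have hd2 : (n - 1) * (Tsq * d) ≤ (n - 1) * (A + 2 * e) :=
    mul_le_mul_of_nonneg_left (by linarith) hn1.le
  rw [hIr, abs_le]
  constructor <;> nlinarith

/-- From the scaled estimate at every `ε` to the limit. -/
theorem tendsto_of_scaled_estimate (x : ℕ → ℝ) (Tsq κ : ℝ) (hT : 0 < Tsq)
    (h : ∀ ε : ℝ, 0 < ε → ∃ N₀ : ℕ, ∀ N : ℕ, N₀ ≤ N → |Tsq * x N - Tsq * κ| ≤ 5 * ε) :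
    Tendsto x atTop (𝓝 κ) := by
  rw [Metric.tendsto_atTop]
  intro ε' hε'
  obtain ⟨N₀, hN₀⟩ := h (Tsq * ε' / 10) (by positivity)
  refine ⟨N₀, fun N hN => ?_⟩
  have h1 := hN₀ N hN
  rw [← mul_sub, abs_mul, abs_of_pos hT] at h1
  have h2 : Tsq * |x N - κ| ≤ Tsq * (ε' / 2) := by linarith
  have h3 : |x N - κ| ≤ ε' / 2 := le_of_mul_le_mul_left h2 hT
  rw [Real.dist_eq]
  linarith

/-- The Abelian split of `∫₀^∞ c` at frequency `ν` (linearity of the Bochner integral; `c ∈ L¹` from (K)). Verbatim the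
`split` step of `StaticAbelianSqueeze.closes`. -/
theorem abelian_split (c : ℝ → ℝ) (ν : ℝ) (hν : 0 < ν) (hc : MeasureTheory.IntegrableOn c (Set.Ioi 0)) :
    ∫ t in Set.Ioi (0:ℝ), c t = (∫ t in Set.Ioi (0:ℝ), Real.exp (-(ν * t)) * c t) +
      ∫ t in Set.Ioi (0:ℝ), (1 - Real.exp (-(ν * t))) * c t := by
  have hcont : Continuous fun t : ℝ => Real.exp (-(ν * t)) := by fun_prop
  have hcont' : Continuous fun t : ℝ => 1 - Real.exp (-(ν * t)) := by fun_prop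
  have hle : ∀ t : ℝ, t ∈ Set.Ioi (0:ℝ) → Real.exp (-(ν * t)) ≤ 1 := fun t ht =>
    Real.exp_le_one_iff.2 (by have : 0 ≤ ν * t := mul_nonneg hν.le (le_of_lt ht); linarith)
  have h1 : MeasureTheory.IntegrableOn (fun t => Real.exp (-(ν * t)) * c t) (Set.Ioi 0) := by
    refine MeasureTheory.Integrable.mono hc (hcont.aestronglyMeasurable.mul hc.aestronglyMeasurable) ?_
    refine (MeasureTheory.ae_restrict_iff' measurableSet_Ioi).2 (Filter.Eventually.of_forall fun t ht => ?_)
    rw [norm_mul, Real.norm_eq_abs, abs_of_pos (Real.exp_pos _)]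
    exact mul_le_of_le_one_left (norm_nonneg _) (hle t ht)
  have h2 : MeasureTheory.IntegrableOn (fun t => (1 - Real.exp (-(ν * t))) * c t) (Set.Ioi 0) := by
    refine MeasureTheory.Integrable.mono hc (hcont'.aestronglyMeasurable.mul hc.aestronglyMeasurable) ?_
    refine (MeasureTheory.ae_restrict_iff' measurableSet_Ioi).2 (Filter.Eventually.of_forall fun t ht => ?_)
    have h0 : 0 ≤ 1 - Real.exp (-(ν * t)) := by linarith [hle t ht]
    have h1' : 1 - Real.exp (-(ν * t)) ≤ 1 := by linarith [Real.exp_pos (-(ν * t))]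
    rw [norm_mul, Real.norm_eq_abs, abs_of_nonneg h0]
    exact mul_le_of_le_one_left (norm_nonneg _) h1'
  calc ∫ t in Set.Ioi (0:ℝ), c t
      = ∫ t in Set.Ioi (0:ℝ), (Real.exp (-(ν * t)) * c t + (1 - Real.exp (-(ν * t))) * c t) := by
        congr 1; funext t; ring
    _ = (∫ t in Set.Ioi (0:ℝ), Real.exp (-(ν * t)) * c t) +
          ∫ t in Set.Ioi (0:ℝ), (1 - Real.exp (-(ν * t))) * c t := MeasureTheory.integral_add h1 h2

/-! ## The composition (kernel-checked, no `sorry` outside the stubs) -/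

/-- **Core of the composition (no seam): at a REGULAR witness the static squeeze gives `Dn → κ`.** For `P` (all `> 0`),
weak-NESS uniqueness `hU`, `T > 0`, a regular witness `(μT, D, κ)`, every steady family `μ` and every response sequence
`Dn`: `Dn → κ`. This is the ∀-regular-witness form of the crux; (R|W) is EQUIVALENT to it modulo (S),(G),(W),(K) and one
response sequence (`uniformAbelianRegularityOfWitness_of_forallRegular` below certifies the converse). -/
theorem tlconv_of_regularWitness {ω₂ lam β γ : ℝ} (hω : 0 < ω₂) (hl : 0 < lam) (hβ : 0 < β) (hγ : 0 < γ)
    (hU : ∀ (N : ℕ) (T_L T_R : ℝ), 0 < T_L → 0 < T_R → ∀ μ ν : Measure (PhaseSpace N),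
      (pinnedChain ω₂ lam β γ).IsSteadyState N T_L T_R μ → (pinnedChain ω₂ lam β γ).IsSteadyState N T_L T_R ν → μ = ν)
    {T : ℝ} (hT : 0 < T) {μT : Measure ChainConfig} {D : InfiniteChainDynamics (pinnedChain ω₂ lam β γ)} {κ : ℝ}
    (hG : (pinnedChain ω₂ lam β γ).IsChainGibbsMeasure T μT) (hS : IsShiftInvariant μT)
    (hss : (pinnedChain ω₂ lam β γ).HasSuperstabilityEstimate μT) (hcar : D.carrier ⊆ (pinnedChain ω₂ lam β γ).bmGood)
    (hP : D.PreservesMeasure μT) (hAC : ∀ t : ℝ, D.HasAbsConvergentCorrelation μT t) (hκ : 0 < κ)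
    (hAbel : Tendsto (fun ν : ℝ => (T ^ 2)⁻¹ *
      ∫ t in Set.Ioi (0 : ℝ), Real.exp (-(ν * t)) * D.currentCorrelation μT t) (𝓝[>] 0) (𝓝 κ))
    (μ : (N : ℕ) → ℝ → ℝ → Measure (PhaseSpace N))
    (hμ : ∀ (N : ℕ) (T_L T_R : ℝ), 0 < T_L → 0 < T_R → (pinnedChain ω₂ lam β γ).IsSteadyState N T_L T_R (μ N T_L T_R))
    (Dn : ℕ → ℝ)
    (hD : ∀ N : ℕ, Tendsto (fun δ : ℝ => (pinnedChain ω₂ lam β γ).totalCurrent (μ N (T + δ / 2) (T - δ / 2)) / δ)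
      (𝓝[≠] 0) (𝓝 (Dn N))) :
    Tendsto Dn atTop (𝓝 κ) := by
  have hT2 : (0:ℝ) < T ^ 2 := by positivity
  have hT2ne : (T ^ 2 : ℝ) ≠ 0 := hT2.ne'
  -- the witness: `Â(ν) → T²κ`
  have hA : Tendsto (fun ν : ℝ => ∫ t in Set.Ioi (0 : ℝ), Real.exp (-(ν * t)) * D.currentCorrelation μT t)
      (𝓝[>] 0) (𝓝 (T ^ 2 * κ)) := by
    have h := hAbel.const_mul (T ^ 2)
    refine h.congr' (Eventually.of_forall fun ν => ?_)
    show T ^ 2 * ((T ^ 2)⁻¹ * _) = _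
    rw [← mul_assoc, mul_inv_cancel₀ hT2ne, one_mul]
  -- an Abel window at every accuracy
  have hwin : ∀ ε : ℝ, 0 < ε → ∃ νa : ℝ, 0 < νa ∧ ∀ ν : ℝ, 0 < ν → ν < νa →
      |(∫ t in Set.Ioi (0 : ℝ), Real.exp (-(ν * t)) * D.currentCorrelation μT t) - T ^ 2 * κ| ≤ ε := by
    intro ε hε
    have hev : ∀ᶠ ν in 𝓝[>] (0:ℝ),
        dist (∫ t in Set.Ioi (0 : ℝ), Real.exp (-(ν * t)) * D.currentCorrelation μT t) (T ^ 2 * κ) < ε :=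
      Metric.tendsto_nhds.1 hA ε hε
    obtain ⟨u, hu, hsub⟩ := mem_nhdsGT_iff_exists_Ioc_subset.1 hev
    refine ⟨u, hu, fun ν hν hνu => ?_⟩
    have h := hsub ⟨hν, hνu.le⟩
    rw [Set.mem_setOf_eq, Real.dist_eq] at h
    exact h.le
  -- the estimate at every ε
  have est : ∀ ε : ℝ, 0 < ε → ∃ N₀ : ℕ, ∀ N : ℕ, N₀ ≤ N → |T ^ 2 * Dn N - T ^ 2 * κ| ≤ 5 * ε := by
    intro ε hε
    obtain ⟨νa, hνa, hAν⟩ := hwin ε hε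
    obtain ⟨ν₀, hν₀, hRν⟩ := stub_uniformAbelianRegularityOfWitness ω₂ lam β γ hω hl hβ hγ T hT
      ⟨μT, D, κ, hG, hP, hAC, hκ, hAbel⟩ ε hε
    have hν : (0:ℝ) < min νa ν₀ / 2 := by positivity
    have hν1 : min νa ν₀ / 2 < νa := by have := min_le_left νa ν₀; linarith
    have hν2 : min νa ν₀ / 2 < ν₀ := by have := min_le_right νa ν₀; linarith
    obtain ⟨N₂, hN₂⟩ := hRν _ hν hν2
    obtain ⟨g, u, hg, hu, hgap⟩ := stub_liouvilleNoGap ω₂ lam β γ hω hl hβ hγ T hT μT hG hS _ hν ε hε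
    have hW := stub_witnessBracket ω₂ lam β γ hω hl hβ hγ T hT μT D hG hS hss hcar hP hAC _ hν g u hg hu
    obtain ⟨N₁, hN₁⟩ := stub_resolventSqueeze ω₂ lam β γ hω hl hβ hγ T hT μT hG hS _ hν g u hg hu ε hε
    refine ⟨max (max N₁ N₂) 2, fun N hN => ?_⟩
    have hN1 : N₁ ≤ N := le_trans (le_trans (le_max_left _ _) (le_max_left _ _)) hN
    have hN2 : N₂ ≤ N := le_trans (le_trans (le_max_right _ _) (le_max_left _ _)) hN
    have hN3 : (2:ℝ) ≤ (N:ℝ) := by exact_mod_cast le_trans (le_max_right _ _) hN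
    have hK := Summit.AtomisticToContinuum.FouriersLaw.Theorems.StaticAbelianSqueeze.kuboAbelIdentity_holds
      ω₂ lam β γ hω hl hβ hγ hU μ hμ T hT N (Dn N) (hD N)
    exact arith_static _ _ _ _ _ _ _ _ _ _ _ hN3 hε (And.left (hN₁ N hN1)) (And.right (hN₁ N hN1)) hgap
      (And.left hW) (And.right hW) (hN₂ N hN2) (abelian_split _ _ hν (And.left hK)) (And.right hK)
      (hAν _ hν hν1)
  exact tendsto_of_scaled_estimate Dn (T ^ 2) κ hT2 est

/-- **Skeleton theorem: the five stubs (+ the landed (K) and seam lemmas) prove the crux BY NAME.** Regularise the witness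
through SI + landed Literature, OUTPUT the regular witness, apply `tlconv_of_regularWitness`. -/
theorem AbelThermodynamicLimit_of :
    Summit.AtomisticToContinuum.FouriersLaw.Theses.LatticeLandauDamping.AbelThermodynamicLimit := by
  intro ω₂ lam β γ hω hl hβ hγ hU T hT hex
  -- SEAM: WLOG shift-invariant (stub SI); then tight ⇒ regular (landed), a.e. good orbits (landed), restrict (landed)
  obtain ⟨μ₁, D₁, κ₁, hG₁, hSI₁, hP₁, hAC₁, hκ₁, hlim₁⟩ :=
    stub_witnessShiftInvariant ω₂ lam β γ hω hl hβ hγ T hT hex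
  haveI : IsProbabilityMeasure μ₁ := hG₁.1
  have htight := oneSiteTight_of_isShiftInvariant (μ := μ₁) hSI₁
  obtain ⟨hS₁, hss₁⟩ :=
    OscillatorChain.isShiftInvariant_and_hasSuperstabilityEstimate_of_tight_pinnedChain γ hω hl.le hβ.le hT hG₁ htight
  have horb : ∀ᵐ σ ∂μ₁, ∀ t : ℝ, D₁.flow t σ ∈ (pinnedChain ω₂ lam β γ).bmGood :=
    OscillatorChain.ae_forall_flow_mem_bmGood_pinnedChain γ hω.le hl hβ hss₁ D₁ hP₁
  obtain ⟨μT, D, κ, hG, hS, hss, hcar, hP, hAC, hκ, hAbel⟩ :=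
    Summit.AtomisticToContinuum.FouriersLaw.Theorems.GreenKuboContinuation.TemperatureBlindVitaliHurwitz.regularWitness_of_regularState_of_aeOrbits
      D₁ hG₁ hP₁ hAC₁ hκ₁ hlim₁ hS₁ hss₁ horb
  refine ⟨μT, D, κ, ⟨hG, hP, hAC, hκ, hAbel⟩, ?_⟩
  intro μ hμ Dn hD
  exact tlconv_of_regularWitness hω hl hβ hγ hU hT hG hS hss hcar hP hAC hκ hAbel μ hμ Dn hD

/-- **The PLANNER-REPAIRED crux (shift-invariance in the hypothesis' witness clause) is closed modulo (S),(G),(W),(R|W)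
— no seam.** Its sorry-cone excludes SI. -/
theorem AbelThermodynamicLimit_of_shiftInvariantWitness :
    ∀ ω₂ lam β γ : ℝ, 0 < ω₂ → 0 < lam → 0 < β → 0 < γ →
      (∀ (N : ℕ) (T_L T_R : ℝ), 0 < T_L → 0 < T_R → ∀ μ ν : Measure (PhaseSpace N),
        (pinnedChain ω₂ lam β γ).IsSteadyState N T_L T_R μ →
        (pinnedChain ω₂ lam β γ).IsSteadyState N T_L T_R ν → μ = ν) →
      ∀ T : ℝ, 0 < T →
        (∃ (μT : Measure ChainConfig) (D : InfiniteChainDynamics (pinnedChain ω₂ lam β γ)) (κ : ℝ),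
          (pinnedChain ω₂ lam β γ).IsChainGibbsMeasure T μT ∧ IsShiftInvariant μT ∧ D.PreservesMeasure μT ∧
          (∀ t : ℝ, D.HasAbsConvergentCorrelation μT t) ∧ 0 < κ ∧
          Tendsto (fun ν : ℝ => (T ^ 2)⁻¹ *
            ∫ t in Set.Ioi (0 : ℝ), Real.exp (-(ν * t)) * D.currentCorrelation μT t) (𝓝[>] 0) (𝓝 κ)) →
        ∃ (μT : Measure ChainConfig) (D : InfiniteChainDynamics (pinnedChain ω₂ lam β γ)) (κ : ℝ),
          ((pinnedChain ω₂ lam β γ).IsChainGibbsMeasure T μT ∧ D.PreservesMeasure μT ∧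
            (∀ t : ℝ, D.HasAbsConvergentCorrelation μT t) ∧ 0 < κ ∧
            Tendsto (fun ν : ℝ => (T ^ 2)⁻¹ *
              ∫ t in Set.Ioi (0 : ℝ), Real.exp (-(ν * t)) * D.currentCorrelation μT t) (𝓝[>] 0) (𝓝 κ)) ∧
          ∀ μ : (N : ℕ) → ℝ → ℝ → Measure (PhaseSpace N),
            (∀ (N : ℕ) (T_L T_R : ℝ), 0 < T_L → 0 < T_R →
              (pinnedChain ω₂ lam β γ).IsSteadyState N T_L T_R (μ N T_L T_R)) →
            ∀ Dn : ℕ → ℝ,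
              (∀ N : ℕ, Tendsto (fun δ : ℝ =>
                (pinnedChain ω₂ lam β γ).totalCurrent (μ N (T + δ / 2) (T - δ / 2)) / δ) (𝓝[≠] 0) (𝓝 (Dn N))) →
              Tendsto Dn atTop (𝓝 κ) := by
  intro ω₂ lam β γ hω hl hβ hγ hU T hT hex
  obtain ⟨μ₁, D₁, κ₁, hG₁, hSI₁, hP₁, hAC₁, hκ₁, hlim₁⟩ := hex
  haveI : IsProbabilityMeasure μ₁ := hG₁.1
  have htight := oneSiteTight_of_isShiftInvariant (μ := μ₁) hSI₁
  obtain ⟨hS₁, hss₁⟩ :=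
    OscillatorChain.isShiftInvariant_and_hasSuperstabilityEstimate_of_tight_pinnedChain γ hω hl.le hβ.le hT hG₁ htight
  have horb : ∀ᵐ σ ∂μ₁, ∀ t : ℝ, D₁.flow t σ ∈ (pinnedChain ω₂ lam β γ).bmGood :=
    OscillatorChain.ae_forall_flow_mem_bmGood_pinnedChain γ hω.le hl hβ hss₁ D₁ hP₁
  obtain ⟨μT, D, κ, hG, hS, hss, hcar, hP, hAC, hκ, hAbel⟩ :=
    Summit.AtomisticToContinuum.FouriersLaw.Theorems.GreenKuboContinuation.TemperatureBlindVitaliHurwitz.regularWitness_of_regularState_of_aeOrbits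
      D₁ hG₁ hP₁ hAC₁ hκ₁ hlim₁ hS₁ hss₁ horb
  refine ⟨μT, D, κ, ⟨hG, hP, hAC, hκ, hAbel⟩, ?_⟩
  intro μ hμ Dn hD
  exact tlconv_of_regularWitness hω hl hβ hγ hU hT hG hS hss hcar hP hAC hκ hAbel μ hμ Dn hD

/-- **Converse certificate: the core (R|W) is NOT stronger than what every line of this crux proves.** At an
admissible point and `T > 0`: the ∀-REGULAR-WITNESS form of the crux (`hAll`, the statement of `tlconv_of_regularWitness`,
which SketchIdeator2 / fekete / loomis / this line all establish) together with (S), (G), (W), SI, the landed (K) and ONE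
response sequence (item `FiniteResponseOfUnique`, stmt-0717, supplies it) gives back (R|W) at `T`. So modulo the shared
infrastructure the residual is EQUIVALENT to the ∀-regular crux — neither a costume nor an over-claim. Proof: regularise
the witness; `Dn → κ`; at `ν` inside the `ε/4`-Abel window, `(N−1)T²Dn N` and `F_N(ν)` are both `2(ε/4)(N−1)`-close to
`(N−1)Â(ν)`… (`arith_converse`). -/
theorem uniformAbelianRegularityOfWitness_of_forallRegular {ω₂ lam β γ : ℝ} (hω : 0 < ω₂) (hl : 0 < lam)
    (hβ : 0 < β) (hγ : 0 < γ)
    (hU : ∀ (N : ℕ) (T_L T_R : ℝ), 0 < T_L → 0 < T_R → ∀ μ ν : Measure (PhaseSpace N),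
      (pinnedChain ω₂ lam β γ).IsSteadyState N T_L T_R μ → (pinnedChain ω₂ lam β γ).IsSteadyState N T_L T_R ν → μ = ν)
    {T : ℝ} (hT : 0 < T)
    (hAll : ∀ (μT : Measure ChainConfig) (D : InfiniteChainDynamics (pinnedChain ω₂ lam β γ)) (κ : ℝ),
      (pinnedChain ω₂ lam β γ).IsChainGibbsMeasure T μT → IsShiftInvariant μT →
      (pinnedChain ω₂ lam β γ).HasSuperstabilityEstimate μT → D.carrier ⊆ (pinnedChain ω₂ lam β γ).bmGood →
      D.PreservesMeasure μT → (∀ t : ℝ, D.HasAbsConvergentCorrelation μT t) → 0 < κ →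
      Tendsto (fun ν : ℝ => (T ^ 2)⁻¹ *
        ∫ t in Set.Ioi (0 : ℝ), Real.exp (-(ν * t)) * D.currentCorrelation μT t) (𝓝[>] 0) (𝓝 κ) →
      ∀ μ : (N : ℕ) → ℝ → ℝ → Measure (PhaseSpace N),
        (∀ (N : ℕ) (T_L T_R : ℝ), 0 < T_L → 0 < T_R →
          (pinnedChain ω₂ lam β γ).IsSteadyState N T_L T_R (μ N T_L T_R)) →
        ∀ Dn : ℕ → ℝ,
          (∀ N : ℕ, Tendsto (fun δ : ℝ =>
            (pinnedChain ω₂ lam β γ).totalCurrent (μ N (T + δ / 2) (T - δ / 2)) / δ) (𝓝[≠] 0) (𝓝 (Dn N))) →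
          Tendsto Dn atTop (𝓝 κ))
    (μ : (N : ℕ) → ℝ → ℝ → Measure (PhaseSpace N))
    (hμ : ∀ (N : ℕ) (T_L T_R : ℝ), 0 < T_L → 0 < T_R → (pinnedChain ω₂ lam β γ).IsSteadyState N T_L T_R (μ N T_L T_R))
    (Dn : ℕ → ℝ)
    (hD : ∀ N : ℕ, Tendsto (fun δ : ℝ => (pinnedChain ω₂ lam β γ).totalCurrent (μ N (T + δ / 2) (T - δ / 2)) / δ)
      (𝓝[≠] 0) (𝓝 (Dn N)))
    (hex : ∃ (μT : Measure ChainConfig) (D : InfiniteChainDynamics (pinnedChain ω₂ lam β γ)) (κ : ℝ),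
      (pinnedChain ω₂ lam β γ).IsChainGibbsMeasure T μT ∧ D.PreservesMeasure μT ∧
      (∀ t : ℝ, D.HasAbsConvergentCorrelation μT t) ∧ 0 < κ ∧
      Tendsto (fun ν : ℝ => (T ^ 2)⁻¹ *
        ∫ t in Set.Ioi (0 : ℝ), Real.exp (-(ν * t)) * D.currentCorrelation μT t) (𝓝[>] 0) (𝓝 κ)) :
    ∀ ε : ℝ, 0 < ε → ∃ ν₀ : ℝ, 0 < ν₀ ∧ ∀ ν : ℝ, 0 < ν → ν < ν₀ → ∃ N₀ : ℕ, ∀ N : ℕ, N₀ ≤ N → let J : Literature.MathematicalPhysics.KineticTheory.HeatConduction.PhaseSpace N → ℝ := fun z => ∑ i : Fin N, (Literature.MathematicalPhysics.KineticTheory.HeatConduction.pinnedChain ω₂ lam β γ).bondCurrent N i z; |∫ t in Set.Ioi (0:ℝ), (1 - Real.exp (-(ν * t))) * ∫ z, J z * (∫ y, J y ∂((Literature.MathematicalPhysics.KineticTheory.HeatConduction.pinnedChain ω₂ lam β γ).transitionKernel N T T t.toNNReal z)) ∂((Literature.MathematicalPhysics.KineticTheory.HeatConduction.pinnedChain ω₂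 lam β γ).gibbsMeasure N T)| ≤ ε * N := by
  have hT2 : (0:ℝ) < T ^ 2 := by positivity
  have hT2ne : (T ^ 2 : ℝ) ≠ 0 := hT2.ne'
  -- regularise the witness (SI + landed) and get `Dn → κ` from the ∀-regular crux
  obtain ⟨μ₁, D₁, κ₁, hG₁, hSI₁, hP₁, hAC₁, hκ₁, hlim₁⟩ :=
    stub_witnessShiftInvariant ω₂ lam β γ hω hl hβ hγ T hT hex
  haveI : IsProbabilityMeasure μ₁ := hG₁.1
  have htight := oneSiteTight_of_isShiftInvariant (μ := μ₁) hSI₁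
  obtain ⟨hS₁, hss₁⟩ :=
    OscillatorChain.isShiftInvariant_and_hasSuperstabilityEstimate_of_tight_pinnedChain γ hω hl.le hβ.le hT hG₁ htight
  have horb : ∀ᵐ σ ∂μ₁, ∀ t : ℝ, D₁.flow t σ ∈ (pinnedChain ω₂ lam β γ).bmGood :=
    OscillatorChain.ae_forall_flow_mem_bmGood_pinnedChain γ hω.le hl hβ hss₁ D₁ hP₁
  obtain ⟨μT, D, κ, hG, hS, hss, hcar, hP, hAC, hκ, hAbel⟩ :=
    Summit.AtomisticToContinuum.FouriersLaw.Theorems.GreenKuboContinuation.TemperatureBlindVitaliHurwitz.regularWitness_of_regularState_of_aeOrbits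
      D₁ hG₁ hP₁ hAC₁ hκ₁ hlim₁ hS₁ hss₁ horb
  have hlim : Tendsto Dn atTop (𝓝 κ) := hAll μT D κ hG hS hss hcar hP hAC hκ hAbel μ hμ Dn hD
  -- the witness: `Â(ν) → T²κ`, and an Abel window
  have hA : Tendsto (fun ν : ℝ => ∫ t in Set.Ioi (0 : ℝ), Real.exp (-(ν * t)) * D.currentCorrelation μT t)
      (𝓝[>] 0) (𝓝 (T ^ 2 * κ)) := by
    have h := hAbel.const_mul (T ^ 2)
    refine h.congr' (Eventually.of_forall fun ν => ?_)
    show T ^ 2 * ((T ^ 2)⁻¹ * _) = _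
    rw [← mul_assoc, mul_inv_cancel₀ hT2ne, one_mul]
  intro ε hε
  have hε4 : 0 < ε / 4 := by positivity
  have hev : ∀ᶠ ν in 𝓝[>] (0:ℝ),
      dist (∫ t in Set.Ioi (0 : ℝ), Real.exp (-(ν * t)) * D.currentCorrelation μT t) (T ^ 2 * κ) < ε / 4 :=
    Metric.tendsto_nhds.1 hA (ε / 4) hε4
  obtain ⟨νa, hνa, hsub⟩ := mem_nhdsGT_iff_exists_Ioc_subset.1 hev
  refine ⟨νa, hνa, fun ν hν hνa' => ?_⟩
  have hAν : |(∫ t in Set.Ioi (0 : ℝ), Real.exp (-(ν * t)) * D.currentCorrelation μT t) - T ^ 2 * κ| ≤ ε / 4 := by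
    have h := hsub ⟨hν, hνa'.le⟩
    rw [Set.mem_setOf_eq, Real.dist_eq] at h
    exact h.le
  obtain ⟨g, u, hg, hu, hgap⟩ := stub_liouvilleNoGap ω₂ lam β γ hω hl hβ hγ T hT μT hG hS ν hν (ε / 4) hε4
  have hW := stub_witnessBracket ω₂ lam β γ hω hl hβ hγ T hT μT D hG hS hss hcar hP hAC ν hν g u hg hu
  obtain ⟨N₁, hN₁⟩ := stub_resolventSqueeze ω₂ lam β γ hω hl hβ hγ T hT μT hG hS ν hν g u hg hu (ε / 4) hε4
  obtain ⟨N₃, hN₃⟩ := Metric.tendsto_atTop.1 hlim (ε / 4 / T ^ 2) (by positivity)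
  refine ⟨max (max N₁ N₃) 2, fun N hN => ?_⟩
  have hN1 : N₁ ≤ N := le_trans (le_trans (le_max_left _ _) (le_max_left _ _)) hN
  have hN3 : N₃ ≤ N := le_trans (le_trans (le_max_right _ _) (le_max_left _ _)) hN
  have hN2 : (2:ℝ) ≤ (N:ℝ) := by exact_mod_cast le_trans (le_max_right _ _) hN
  have hK := Summit.AtomisticToContinuum.FouriersLaw.Theorems.StaticAbelianSqueeze.kuboAbelIdentity_holds
    ω₂ lam β γ hω hl hβ hγ hU μ hμ T hT N (Dn N) (hD N)
  have hDn : |T ^ 2 * Dn N - T ^ 2 * κ| ≤ ε / 4 := by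
    have h := hN₃ N hN3
    rw [Real.dist_eq] at h
    rw [← mul_sub, abs_mul, abs_of_pos hT2]
    calc T ^ 2 * |Dn N - κ| ≤ T ^ 2 * (ε / 4 / T ^ 2) := mul_le_mul_of_nonneg_left h.le hT2.le
      _ = ε / 4 := by field_simp
  refine le_trans (arith_converse _ _ _ _ _ _ _ _ _ _ _ hN2 hε4 (And.left (hN₁ N hN1)) (And.right (hN₁ N hN1)) hgap
    (And.left hW) (And.right hW) (abelian_split _ _ hν (And.left hK)) (And.right hK) hAν hDn) (le_of_eq ?_)
  ring

/-- The same term closes the sibling crux (the two decls are `Iff.rfl`). Not a proof claim either. -/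
theorem siblingCrux_of :
    Summit.AtomisticToContinuum.FouriersLaw.Theses.EmbeddedDrudeMourre.AbelThermodynamicLimit :=
  crux_iff_sibling.1 AbelThermodynamicLimit_of

end Summit.AtomisticToContinuum.FouriersLaw.Cruxes.AbelThermodynamicLimit.StaticSqueezeWitnessBracket

end
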